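import Summits.QuantumFields.BalabanUV.Beta.CombHId2Periodised
import Summits.QuantumFields.BalabanUV.Beta.CombHId1Record

/-!
# `BalabanUV.Beta.CombHId2Record` — binder row D1 (OWNER an2), (J-a) dictionary, (C2) at ORDER 2 AT THE (III′) RECORD: **THE LEVEL-`(j+1)` SECOND-ORDER
# TABLE OF THE COMB-CHART LITERAL, BOUND THE DOOR's WAY (second bond copy-summed, then periodised), SPLITS INTO `(cE₂·wV4 (j+1)) •` THE FOURTH VALUE JET
# OVER THE PERIODISED LEVEL-`j` TABLES `+ (cB·wB2 (j+1)) •` THE FRESH BORDER TERM** — the order-2 twin of `CombHId1Record.dper_ScombOf_succ_eq_e3OfK_dper`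

WHY.  At the (III′) literal (`CombChartStepJets`: resolvents `GcombSh Lc j`, pure first-order tables `SpureCombOf tabs … j`, multiplier tables `tabs.M j`,
second-order tables `WcombOf tabs … j = WrecOf (GcombSh Lc) (SpureCombOf …) tabs.M … j`) the order-2 recursion is `RecursiveWSlot.T2RecOf_succ`:
`T2_{j+1} b b′ = (cE₂·wV4 (j+1)) • e4OfKW Lc (GcombSh Lc j) (SpureCombOf j) (tabs.M j) (WcombOf j) b b′ + (cB·wB2 (j+1)) • vh₂S b b′`.  `CombHId2Periodised` proved,
for GENERIC sockets, that «copy-sum in the second bond, then `dper`» passes `e4OfKW` onto the periodised tables.  This file DISCHARGES the sockets at the record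
(every `SymTables d Lc` record, every level `j`, every fine box `M = Lc·M′`) and states the split.
WHAT ([folklore]; 0 `def`, 0 cited fact, 0 `def … : Prop`, 0 sorry):
§1 SOCKETS: `cperiodCov_of_shiftK_cov` (bridge: a COARSE-bond family with the record's `(TM)` shape is `M′`-period covariant on the fine box), `periodCov_SpureCombOf`,
`periodCov_tabsM`, `translate_inv_GcombSh`, `exists_farSmall_WcombOf` (`(LW)` + `WrecOf_swap` ⇒ far-small at the first bond, `biLoc_far_of_pair`),
`exists_locStencil₂_e4OfKW_comb`, `exists_locStencil₂_vh₂S`; §2 `tsum_T2comb_succ_apply` (the copy sum splits termwise, pointwise), `dper_smul_add_smul`,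
**`dper_tsum_T2comb_succ`**: `dper M′ (x z ↦ Σ'_n T2_{j+1} b (b′+M′∘n) x z) = (cE₂·wV4 (j+1)) • e4OfKW Lc (GcombSh Lc j) S^per_j M^per_j W^{per,cs}_j b b′
+ (cB·wB2 (j+1)) • dper M′ (x z ↦ Σ'_n vh₂S b (b′+M′∘n) x z)`, **`perF_dper_tsum_T2comb_succ`** (the same on the coarse torus: `perF_add` + `perF_smul`).
NOT HERE: the door's `hId₂` (part THREE), any estimate; nothing of Bałaban's asserted; `D1Tel` ∕ `D1Rep`
OPEN; NOT (T-ID), NOT D1, NEVER «G-an2-4 closed», NOT BetaPertH, NOT continuum, NOT Clay.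

HONEST DEPENDENCY (page 1, mandatory): continuum YM on T⁴ ⇐ BetaPertH ∧ nine spine estimates (0/9 proved); BetaPertH ⇐ (D1) ∧ (D4) ∧ CAP+tail;
G-an2-4 gates asym, D1 and NE2/3/4.  HONEST FRAMING (cell contract, verbatim): «discharging `BetaPertH` makes Bałaban's UV stability UNCONDITIONAL —
a real constructive-QFT result; it is NOT the continuum limit and NOT the Clay problem.»  ABSOLUTE RULE (cell charter, verbatim): «No internally-minted
statement may enter as a cited fact. Every hypothesis is either kernel-proved in this package or a verbatim quotation of a PUBLISHED theorem with page
reference. The manuscript(s) under audit are NOT citable for their own disputed steps — they are the thing under adjudication; programme-internal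
(2001/route/tribunal) claims are never citable.»  Row D1 OWNER an2 (b2b-balaban-beta-an2) gen 44, 2026-08-23; over `CombHId2Periodised`, `CombHId1Record`,
`CombChartStepJets`, `SpineRecursiveW`, `RecursiveWSlot` BY NAME.  No existing file touched.
-/

noncomputable section

open scoped BigOperators

namespace Summit.QuantumFields.BalabanUV.Beta.CombHId2Record

open Literature.MathematicalPhysics.QuantumFieldTheory.Balaban1983to89
open Literature.MathematicalPhysics.QuantumFieldTheory.Balaban1983to89.Beta
open B12Sec2to5 (l1 l1_nonneg)
open B4TorusKernel.MultiPeriod (translate translate_apply)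
open B4Sect5Proof (latticeConst latticeConst_nonneg)
open ExpKernelCalculus (MKer Decays BiLoc VertexFamily VertexFamily₂ comp shiftK l1_sub_symm)
open AffineAveraging (Site)
open OneStepResolventKernel (Fib LocStencil decays_mono biLoc_mono)
open BalabanCompositeJets (LocStencil₂)
open BalabanStepW2 (wV4 wB2 biLoc_le_mono biLoc_far_of_pair)
open Summit.QuantumFields.BalabanUV.Beta.SpineRooted (e4OfKW T2RecOf WrecOf T2RecOf_succ WrecOf_swap locStencil₂_e4OfKW)
open Summit.QuantumFields.BalabanUV.Beta.AxialDressingRooted (one_le_of_neZero)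
open Summit.QuantumFields.BalabanUV.Beta.FP.KernelPeriodisationFib (translate_eq_add translate_invariant_of_shiftK)
open Summit.QuantumFields.BalabanUV.Beta.FP.KernelPeriodisationFibLoc (dper dper_apply summable_dper)
open Summit.QuantumFields.BalabanUV.Beta.SymmetrisedStepJets (SymTables)
open Summit.QuantumFields.BalabanUV.Beta.CombChartStepJets (GcombSh SpureCombOf WcombOf SpureCombOf_translate locStencil_SpureCombOf vertexFamily₂_WcombOf
  decays_GcombSh)
open Summit.QuantumFields.BalabanUV.Beta.CombHId1Letters (periodCov_of_shiftK_cov)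
open Summit.QuantumFields.BalabanUV.Beta.CombHId2CopySum (summable_family_apply biLoc_tsum_family nsmul_per)
open Summit.QuantumFields.BalabanUV.Beta.CombHId2Periodised (dper_tsum_e4OfKW_translate)

variable {d : ℕ} (M : Fin (d + 1) → ℕ) [∀ μ, NeZero (M μ)]

/-! ## §1 The sockets at the record -/

section Sockets

variable {Lc : ℕ} [NeZero Lc] {M' : Fin (d + 1) → ℕ} (tabs : SymTables d Lc) (cE cVH cΛ cE₂ cB : ℝ) (T : Fin 4 → Fin 4 → Fin 4 → Fin 4 → ℝ)

omit [∀ μ, NeZero (M μ)] [NeZero Lc] in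
/-- [folklore] **BRIDGE for COARSE-bond families**: a family with the record's `(TM)` shape `Mt ρ (w + t) = shiftK (−Lc•t) (Mt ρ w)` is `M′`-period covariant in
C3a's sense on every fine box `M = Lc·M′` (the coarse period translate `w + M′∘m` is `t := M′∘m`, and `Lc•(M′∘m) = M∘m`). -/
theorem cperiodCov_of_shiftK_cov (hM : ∀ i, M i = Lc * M' i) {Mt : Fin (d + 1) → Site (d + 1) → MKer (d + 1) (Fib d)}
    (hMt : ∀ (ρ : Fin (d + 1)) (w t : Site (d + 1)), Mt ρ (w + t) = shiftK (-((Lc : ℤ) • t)) (Mt ρ w))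
    (ρ : Fin (d + 1)) (w m x z : Site (d + 1)) (a b : Fib d) :
    Mt ρ (translate M' w m) (translate M x m) (translate M z m) a b = Mt ρ w x z a b := by
  rw [translate_eq_add M' w m, hMt ρ w, translate_eq_add M x m, translate_eq_add M z m, ← nsmul_per M hM m]
  show Mt ρ w (x + (Lc : ℤ) • (fun i => (M' i : ℤ) * m i) + -((Lc : ℤ) • fun i => (M' i : ℤ) * m i))
    (z + (Lc : ℤ) • (fun i => (M' i : ℤ) * m i) + -((Lc : ℤ) • fun i => (M' i : ℤ) * m i)) a b = Mt ρ w x z a b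
  rw [add_neg_cancel_right, add_neg_cancel_right]

omit [∀ μ, NeZero (M μ)] in
/-- [folklore] the pure first-order tables of the literal are period covariant on every box with `Lc ∣ M i` (`(St♭)` through C2a's bridge). -/
theorem periodCov_SpureCombOf (hLM : ∀ i, Lc ∣ M i) (j : ℕ) (κ : Fin (d + 1)) (u m x z : Site (d + 1)) (a b : Fib d) :
    SpureCombOf tabs cE cVH cΛ j κ (translate M u m) (translate M x m) (translate M z m) a b = SpureCombOf tabs cE cVH cΛ j κ u x z a b :=
  periodCov_of_shiftK_cov M (S := SpureCombOf tabs cE cVH cΛ j) (fun κ u t => SpureCombOf_translate tabs cE cVH cΛ j κ u t) hLM κ u m x z a b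

omit [∀ μ, NeZero (M μ)] [NeZero Lc] in
/-- [folklore] the record's multiplier tables `tabs.M j` are `M′`-period covariant on every fine box `M = Lc·M′` (`(TM)` through §1's bridge). -/
theorem periodCov_tabsM (hM : ∀ i, M i = Lc * M' i) (j : ℕ) (ρ : Fin (d + 1)) (w m x z : Site (d + 1)) (a b : Fib d) :
    tabs.M j ρ (translate M' w m) (translate M x m) (translate M z m) a b = tabs.M j ρ w x z a b :=
  cperiodCov_of_shiftK_cov M hM (fun ρ w t => tabs.hMt j ρ w t) ρ w m x z a b

omit [∀ μ, NeZero (M μ)] in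
/-- [folklore] the comb resolvent is invariant under every fine period lattice with `Lc ∣ M i` (an2's `shiftK_GcombSh′` through gan24-p3's `translate_invariant_of_shiftK`). -/
theorem translate_inv_GcombSh (hLM : ∀ i, Lc ∣ M i) (j : ℕ) (m x z : Site (d + 1)) (a b : Fib d) :
    GcombSh (d := d) Lc j (translate M x m) (translate M z m) a b = GcombSh (d := d) Lc j x z a b :=
  translate_invariant_of_shiftK M (FP.RelInvPeriodisedComb.shiftK_GcombSh' j) hLM m x z a b

/-- [folklore] **THE LITERAL's SECOND-ORDER TABLES ARE FAR-SMALL AT THEIR FIRST BOND**: `(LW)` (`vertexFamily₂_WcombOf`) + the swap symmetry `WrecOf_swap`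
give, by `BalabanStepW2.biLoc_far_of_pair`, `BiLoc (W_j b b′) (Lc•b.2) (Lc•b.2) (Cw·e^{−δ|Lc•b′.2 − Lc•b.2|₁}) δ` for some `Cw`, `δ > 0` — the `hW` socket of
`CombHId2Periodised`. -/
theorem exists_farSmall_WcombOf (j : ℕ) :
    ∃ Cw δw : ℝ, 0 < δw ∧ ∀ (μ : Fin (d + 1)) (y : Site (d + 1)) (ν : Fin (d + 1)) (y' : Site (d + 1)),
      BiLoc (WcombOf tabs cE cVH cΛ cE₂ cB T j μ y ν y') ((Lc : ℤ) • y) ((Lc : ℤ) • y)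
        (Cw * Real.exp (-δw * l1 ((Lc : ℤ) • y' - (Lc : ℤ) • y))) δw := by
  obtain ⟨Cw, δ, hδ, hW⟩ := vertexFamily₂_WcombOf tabs cE cVH cΛ cE₂ cB T j
  have hCw : 0 ≤ Cw := (hW 0 0 0 0).nonneg (Sum.inl 0)
  refine ⟨Cw, δ / 4, by positivity, fun μ y ν y' => ?_⟩
  have h1 : BiLoc (WcombOf tabs cE cVH cΛ cE₂ cB T j μ y ν y') ((Lc : ℤ) • y) ((Lc : ℤ) • y') Cw δ := hW μ y ν y'
  have h2 : BiLoc (WcombOf tabs cE cVH cΛ cE₂ cB T j μ y ν y') ((Lc : ℤ) • y') ((Lc : ℤ) • y) Cw δ := by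
    have h := hW ν y' μ y
    rwa [show WcombOf tabs cE cVH cΛ cE₂ cB T j ν y' μ y = WcombOf tabs cE cVH cΛ cE₂ cB T j μ y ν y' from
      WrecOf_swap _ _ _ _ _ _ _ _ j μ y ν y'] at h
  refine biLoc_le_mono (biLoc_far_of_pair h1 h2 hδ.le) (by positivity) ?_ le_rfl
  exact mul_le_mul_of_nonneg_left (Real.exp_le_exp.2 (by nlinarith [l1_nonneg ((Lc : ℤ) • y' - (Lc : ℤ) • y)])) hCw

/-- [folklore] the level-`(j+1)` chain part `e4OfKW Lc (GcombSh Lc j) (SpureCombOf j) (tabs.M j) (WcombOf j)` is a `LocStencil₂` family (an2's `locStencil₂_e4OfKW`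
fed the record's `(DG)(LS♭)(LM)(LW)` and `WrecOf_swap`). -/
theorem exists_locStencil₂_e4OfKW_comb (j : ℕ) :
    ∃ C δ : ℝ, 0 < δ ∧ LocStencil₂ (e4OfKW Lc (GcombSh (d := d) Lc j) (SpureCombOf tabs cE cVH cΛ j) (tabs.M j) (WcombOf tabs cE cVH cΛ cE₂ cB T j)) C δ :=
  locStencil₂_e4OfKW (one_le_of_neZero Lc) (decays_GcombSh (d := d) Lc j) (locStencil_SpureCombOf tabs cE cVH cΛ j) (tabs.hM j)
    (vertexFamily₂_WcombOf tabs cE cVH cΛ cE₂ cB T j) (fun μ y ν y' => WrecOf_swap _ _ _ _ _ _ _ _ j μ y ν y')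

omit [∀ μ, NeZero (M μ)] [NeZero Lc] in
/-- [folklore] a `LocStencil₂` family, its second bond running over the coarse period copies, is a far-small family at the first bond in the sense of C3c §1:
constants `C·e^{−δ|u′+M′∘n−u|₁}`, summable in `n`. -/
theorem family_of_locStencil₂ [∀ μ, NeZero (M' μ)] {X : Fin (d + 1) → Site (d + 1) → Fin (d + 1) → Site (d + 1) → MKer (d + 1) (Fib d)} {C δ : ℝ}
    (hX : LocStencil₂ X C δ) (hδ : 0 < δ) (κ : Fin (d + 1)) (u : Site (d + 1)) (κ' : Fin (d + 1)) (u' : Site (d + 1)) :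
    (∀ n x z a b, |X κ u κ' (translate M' u' n) x z a b| ≤ (C * Real.exp (-δ * l1 (translate M' u' n - u))) * Real.exp (-δ * (l1 (x - u) + l1 (z - u)))) ∧
      Summable (fun n => C * Real.exp (-δ * l1 (translate M' u' n - u))) ∧ ∀ n, 0 ≤ C * Real.exp (-δ * l1 (translate M' u' n - u)) := by
  have hC : 0 ≤ C := by
    have h := (hX κ u κ u).nonneg (Sum.inl 0)
    rwa [sub_self, show l1 (0 : Site (d + 1)) = 0 by simp [l1], mul_zero, Real.exp_zero, mul_one] at h
  exact ⟨fun n x z a b => hX κ u κ' (translate M' u' n) x z a b,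
    ((FP.KernelPeriodisationFibLoc.summable_exp_l1_translate M' hδ u u').1).mul_left C, fun n => by positivity⟩

end Sockets

/-! ## §2 The level split at order 2 -/

section Split

variable {Lc : ℕ} [NeZero Lc] {M' : Fin (d + 1) → ℕ} [∀ μ, NeZero (M' μ)] (tabs : SymTables d Lc) (cE cVH cΛ cE₂ cB : ℝ)
  (T : Fin 4 → Fin 4 → Fin 4 → Fin 4 → ℝ)

omit [∀ μ, NeZero (M μ)] in
/-- [folklore] **THE COPY SUM OF THE LEVEL-`(j+1)` SECOND-ORDER TABLE SPLITS TERMWISE** (pointwise; both families are `LocStencil₂`, hence pointwise summable in `n`). -/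
theorem tsum_T2comb_succ_apply (j : ℕ) (μ : Fin (d + 1)) (y : Site (d + 1)) (ν : Fin (d + 1)) (y' : Site (d + 1)) (x z : Site (d + 1)) (a b : Fib d) :
    ∑' n, T2RecOf d Lc (GcombSh Lc) (SpureCombOf tabs cE cVH cΛ) tabs.M cE₂ cB T tabs.vh₂S tabs.mixFF (j + 1) μ y ν (translate M' y' n) x z a b
      = (cE₂ * wV4 d Lc (j + 1)) *
          ∑' n, e4OfKW Lc (GcombSh (d := d) Lc j) (SpureCombOf tabs cE cVH cΛ j) (tabs.M j) (WcombOf tabs cE cVH cΛ cE₂ cB T j) μ y ν (translate M' y' n) x z a b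
        + (cB * wB2 d Lc (j + 1)) * ∑' n, tabs.vh₂S μ y ν (translate M' y' n) x z a b := by
  obtain ⟨C₁, δ₁, hδ₁, h₁⟩ := exists_locStencil₂_e4OfKW_comb tabs cE cVH cΛ cE₂ cB T j
  obtain ⟨C₂, δ₂, hδ₂, h₂⟩ := tabs.hB
  obtain ⟨hT₁, hg₁, -⟩ := family_of_locStencil₂ (M' := M') h₁ hδ₁ μ y ν y'
  obtain ⟨hT₂, hg₂, -⟩ := family_of_locStencil₂ (M' := M') h₂ hδ₂ μ y ν y'
  have s₁ := (summable_family_apply hT₁ hg₁ x z a b).mul_left (cE₂ * wV4 d Lc (j + 1))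
  have s₂ := (summable_family_apply hT₂ hg₂ x z a b).mul_left (cB * wB2 d Lc (j + 1))
  rw [← tsum_mul_left, ← tsum_mul_left, ← s₁.tsum_add s₂]
  refine tsum_congr fun n => ?_
  rw [T2RecOf_succ]
  rfl

/-- [folklore] `dper` of `a • A + b • B` for bi-localised `A, B`. -/
theorem dper_smul_add_smul {A B : MKer (d + 1) (Fib d)} {pA pB : Site (d + 1)} {CA δA CB δB : ℝ}
    (hA : BiLoc A pA pA CA δA) (hδA : 0 < δA) (hB : BiLoc B pB pB CB δB) (hδB : 0 < δB) (a b : ℝ) :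
    dper M (a • A + b • B) = a • dper M A + b • dper M B := by
  funext x y e f
  simp only [dper_apply, Pi.add_apply, Pi.smul_apply, smul_eq_mul]
  have h1 := (summable_dper M hA (hA.nonneg (Sum.inl 0)) hδA x y e f).mul_left a
  have h2 := (summable_dper M hB (hB.nonneg (Sum.inl 0)) hδB x y e f).mul_left b
  rw [h1.tsum_add h2, tsum_mul_left, tsum_mul_left]

/-- [folklore] **THE LEVEL SPLIT AT ORDER 2 — THE LEVEL-`(j+1)` SECOND-ORDER TABLE OF THE (III′) LITERAL, COPY-SUMMED IN THE SECOND BOND AND PERIODISED ON THE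
COARSE TORUS, IS `(cE₂·wV4 (j+1)) •` THE FOURTH VALUE JET OVER THE PERIODISED LEVEL-`j` TABLES PLUS `(cB·wB2 (j+1)) •` THE FRESH BORDER TERM** (every `SymTables d Lc`
record, every `j`, every fine box `M = Lc·M′`):
`dper M′ (x z ↦ Σ'_n T2_{j+1} b (b′+M′∘n) x z) = (cE₂·wV4 (j+1)) • e4OfKW Lc (GcombSh Lc j) S^per_j M^per_j W^{per,cs}_j b b′ + (cB·wB2 (j+1)) • dper M′ (x z ↦ Σ'_n vh₂S b (b′+M′∘n) x z)`,
`S^per_j κ u := dper M (SpureCombOf j κ u)`, `M^per_j ρ w := dper M (tabs.M j ρ w)`, `W^{per,cs}_j b b′ := dper M (x z ↦ Σ'_n WcombOf j b (b′+M′∘n) x z)`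
(`CombHId2Periodised.dper_tsum_e4OfKW_translate` with its sockets discharged by §1). -/
theorem dper_tsum_T2comb_succ (hM : ∀ i, M i = Lc * M' i) (j : ℕ) (μ : Fin (d + 1)) (y : Site (d + 1)) (ν : Fin (d + 1)) (y' : Site (d + 1)) :
    dper M' (fun x z a b => ∑' n, T2RecOf d Lc (GcombSh Lc) (SpureCombOf tabs cE cVH cΛ) tabs.M cE₂ cB T tabs.vh₂S tabs.mixFF (j + 1) μ y ν
        (translate M' y' n) x z a b)
      = (cE₂ * wV4 d Lc (j + 1)) • e4OfKW Lc (GcombSh (d := d) Lc j) (fun κ u => dper M (SpureCombOf tabs cE cVH cΛ j κ u))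
            (fun ρ w => dper M (tabs.M j ρ w))
            (fun μ y ν y' => dper M (fun x z a b => ∑' n, WcombOf tabs cE cVH cΛ cE₂ cB T j μ y ν (translate M' y' n) x z a b)) μ y ν y'
        + (cB * wB2 d Lc (j + 1)) • dper M' (fun x z a b => ∑' n, tabs.vh₂S μ y ν (translate M' y' n) x z a b) := by
  have hLM : ∀ i, Lc ∣ M i := fun i => ⟨M' i, hM i⟩
  obtain ⟨C₁, δ₁, hδ₁, h₁⟩ := exists_locStencil₂_e4OfKW_comb tabs cE cVH cΛ cE₂ cB T j
  obtain ⟨C₂, δ₂, hδ₂, h₂⟩ := tabs.hB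
  obtain ⟨hT₁, hg₁, -⟩ := family_of_locStencil₂ (M' := M') h₁ hδ₁ μ y ν y'
  obtain ⟨hT₂, hg₂, -⟩ := family_of_locStencil₂ (M' := M') h₂ hδ₂ μ y ν y'
  have hA := biLoc_tsum_family hT₁ hg₁
  have hB := biLoc_tsum_family hT₂ hg₂
  -- step 1: the copy sum splits (pointwise), as kernels
  have h1 : (fun x z a b => ∑' n, T2RecOf d Lc (GcombSh Lc) (SpureCombOf tabs cE cVH cΛ) tabs.M cE₂ cB T tabs.vh₂S tabs.mixFF (j + 1) μ y ν
        (translate M' y' n) x z a b)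
      = (cE₂ * wV4 d Lc (j + 1)) • (fun x z a b => ∑' n, e4OfKW Lc (GcombSh (d := d) Lc j) (SpureCombOf tabs cE cVH cΛ j) (tabs.M j)
            (WcombOf tabs cE cVH cΛ cE₂ cB T j) μ y ν (translate M' y' n) x z a b)
        + (cB * wB2 d Lc (j + 1)) • (fun x z a b => ∑' n, tabs.vh₂S μ y ν (translate M' y' n) x z a b) := by
    funext x z a b
    rw [tsum_T2comb_succ_apply tabs cE cVH cΛ cE₂ cB T j μ y ν y' x z a b]
    rfl
  rw [h1, dper_smul_add_smul M' hA hδ₁ hB hδ₂]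
  -- step 2: the sockets of `CombHId2Periodised` at the record
  obtain ⟨δG, CG, hδG, hCG, hG⟩ := decays_GcombSh (d := d) (Lc := Lc) j
  obtain ⟨CS, δS, hδS, hS⟩ := locStencil_SpureCombOf tabs cE cVH cΛ j
  obtain ⟨CM, δM, hδM, hMloc⟩ := tabs.hM j
  obtain ⟨Cw, δw, hδw, hW⟩ := exists_farSmall_WcombOf tabs cE cVH cΛ cE₂ cB T j
  rw [dper_tsum_e4OfKW_translate M hM (translate_inv_GcombSh M hLM j) hG hCG hδG (periodCov_SpureCombOf M tabs cE cVH cΛ hLM j) hS hδS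
    (periodCov_tabsM M tabs hM j) hMloc hδM hW hδw μ y ν y']

/-- [folklore] **THE COARSE-TORUS MATRICES OF THE LEVEL-`(j+1)` SECOND-ORDER TABLE SPLIT TERMWISE** (the consumer's currency; `perF_add` + `perF_smul` on §2):
`perF M′ (dper M′ (x z ↦ Σ'_n T2_{j+1} b (b′+M′∘n) x z)) = (cE₂·wV4 (j+1)) • perF M′ (e4OfKW Lc (GcombSh Lc j) S^per_j M^per_j W^{per,cs}_j b b′)
+ (cB·wB2 (j+1)) • perF M′ (dper M′ (x z ↦ Σ'_n vh₂S b (b′+M′∘n) x z))`. -/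
theorem perF_dper_tsum_T2comb_succ (hM : ∀ i, M i = Lc * M' i) (j : ℕ) (μ : Fin (d + 1)) (y : Site (d + 1)) (ν : Fin (d + 1)) (y' : Site (d + 1)) :
    FP.KernelPeriodisationFib.perF M' (dper M' (fun x z a b => ∑' n, T2RecOf d Lc (GcombSh Lc) (SpureCombOf tabs cE cVH cΛ) tabs.M cE₂ cB T tabs.vh₂S
        tabs.mixFF (j + 1) μ y ν (translate M' y' n) x z a b))
      = (cE₂ * wV4 d Lc (j + 1)) • FP.KernelPeriodisationFib.perF M' (e4OfKW Lc (GcombSh (d := d) Lc j)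
            (fun κ u => dper M (SpureCombOf tabs cE cVH cΛ j κ u)) (fun ρ w => dper M (tabs.M j ρ w))
            (fun μ y ν y' => dper M (fun x z a b => ∑' n, WcombOf tabs cE cVH cΛ cE₂ cB T j μ y ν (translate M' y' n) x z a b)) μ y ν y')
        + (cB * wB2 d Lc (j + 1)) • FP.KernelPeriodisationFib.perF M' (dper M' (fun x z a b => ∑' n, tabs.vh₂S μ y ν (translate M' y' n) x z a b)) := by
  have hLM : ∀ i, Lc ∣ M i := fun i => ⟨M' i, hM i⟩
  obtain ⟨C₁, δ₁, hδ₁, h₁⟩ := exists_locStencil₂_e4OfKW_comb tabs cE cVH cΛ cE₂ cB T j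
  obtain ⟨C₂, δ₂, hδ₂, h₂⟩ := tabs.hB
  obtain ⟨hT₁, hg₁, hg₁0⟩ := family_of_locStencil₂ (M' := M') h₁ hδ₁ μ y ν y'
  obtain ⟨hT₂, hg₂, hg₂0⟩ := family_of_locStencil₂ (M' := M') h₂ hδ₂ μ y ν y'
  have hA := biLoc_tsum_family hT₁ hg₁
  have hB := biLoc_tsum_family hT₂ hg₂
  have hA0 : 0 ≤ ∑' n, C₁ * Real.exp (-δ₁ * l1 (translate M' y' n - y)) := tsum_nonneg hg₁0
  have hB0 : 0 ≤ ∑' n, C₂ * Real.exp (-δ₂ * l1 (translate M' y' n - y)) := tsum_nonneg hg₂0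
  have hdA := CombHId1Record.decays_smul' (FP.KernelPeriodisationFibLoc.decays_dper_diag M' hA hA0 hδ₁) (cE₂ * wV4 d Lc (j + 1))
  have hdB := CombHId1Record.decays_smul' (FP.KernelPeriodisationFibLoc.decays_dper_diag M' hB hB0 hδ₂) (cB * wB2 d Lc (j + 1))
  have h1 : (fun x z a b => ∑' n, T2RecOf d Lc (GcombSh Lc) (SpureCombOf tabs cE cVH cΛ) tabs.M cE₂ cB T tabs.vh₂S tabs.mixFF (j + 1) μ y ν
        (translate M' y' n) x z a b)
      = (cE₂ * wV4 d Lc (j + 1)) • (fun x z a b => ∑' n, e4OfKW Lc (GcombSh (d := d) Lc j) (SpureCombOf tabs cE cVH cΛ j) (tabs.M j)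
            (WcombOf tabs cE cVH cΛ cE₂ cB T j) μ y ν (translate M' y' n) x z a b)
        + (cB * wB2 d Lc (j + 1)) • (fun x z a b => ∑' n, tabs.vh₂S μ y ν (translate M' y' n) x z a b) := by
    funext x z a b
    rw [tsum_T2comb_succ_apply tabs cE cVH cΛ cE₂ cB T j μ y ν y' x z a b]
    rfl
  obtain ⟨δG, CG, hδG, hCG, hG⟩ := decays_GcombSh (d := d) (Lc := Lc) j
  obtain ⟨CS, δS, hδS, hS⟩ := locStencil_SpureCombOf tabs cE cVH cΛ j
  obtain ⟨CM, δM, hδM, hMloc⟩ := tabs.hM j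
  obtain ⟨Cw, δw, hδw, hW⟩ := exists_farSmall_WcombOf tabs cE cVH cΛ cE₂ cB T j
  rw [h1, dper_smul_add_smul M' hA hδ₁ hB hδ₂, FP.KernelPeriodisationFib.perF_add M' hdA hdB (half_pos hδ₁) (half_pos hδ₂),
    FP.KernelPeriodisationFib.perF_smul, FP.KernelPeriodisationFib.perF_smul,
    dper_tsum_e4OfKW_translate M hM (translate_inv_GcombSh M hLM j) hG hCG hδG (periodCov_SpureCombOf M tabs cE cVH cΛ hLM j) hS hδS
      (periodCov_tabsM M tabs hM j) hMloc hδM hW hδw μ y ν y']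

end Split

end Summit.QuantumFields.BalabanUV.Beta.CombHId2Record

end
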